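import Summits.BirchSwinnertonDyer.Rank1Residual.GaloisImage.CanonicalKolyvaginDatum
import Summits.BirchSwinnertonDyer.Rank1Residual.GaloisImage.SakamotoN11InstanceWeil
import HarnessLib

/-!
# The N11 instance of Sakamoto 2024 Thm. 4.4 (1) with THE canonical Kolyvagin datum supplied
# (cell `b2b-bsdres`, team n1011, seat p04 gen 4, OWNERS row T-HCC; consumer corollary)

HONEST FRAMING (cell `b2b-bsdres`, run/shared/lean/b2b/bsd-rank1-residual/, verbatim in every
file): the goal of the cell is to DELETE the COMBINATION-SHAPED residual classes of the
Birch–Swinnerton-Dyer formula for ALL analytic-rank `≤ 1` elliptic curves over `ℚ` — "full BSD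
formula for every rank `≤ 1` curve in class `C`" assembled STRICTLY from published theorems — so
that the rank-`≤ 1` remainder becomes exactly the CONSTRUCTION-SHAPED classes, which are TYPED
(missing-input `Prop`s), NOT attempted. This is not "finishing BSD". Team n1011 (N10 / N11, the
additive block X4 ∧ `p = 3`): research route on the CONSTRUCTION-SHAPED class X4; no claim beyond the
stated classes; nothing is booked. Theorems only (no definition, no named fact, no `sorry`).

## What is proved

n1011-p13's `kolyvaginSystems_freeRankOne_propagatedSelmerStructure` (p255331) and n1011-p18's
`…_weil` (p257091) carry the Kolyvagin datum as binders
`(D) (η) (hP : D.primes = frobeniusClassPrimes …) (hT : D.transverse = cyclotomicTransverse …)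
(hD : D.HasCanonicalComparison (3^(k+1)) η)`.  With row T-HCC
(`FSComp.exists_kolyvaginDatum_hasCanonicalComparison_frobeniusClassPrimes`,
`GaloisImage/CanonicalKolyvaginDatum`) these are DISCHARGED from `hτμ`, `hτq` alone:

* `exists_kolyvaginDatum_freeRankOne_propagatedSelmerStructure`: p13's theorem with the datum
  EXISTENTIALLY supplied — for every family `η` of primitive roots at Sakamoto's primes there is
  `D` with Sakamoto's primes, the cyclotomic transverse conditions, THE canonical comparison maps,
  AND `KS₁(E[3^{k+1}], 𝓕_can, 𝒫)` free of rank one over `ℤ/3^{k+1}` (+ the bijectivity clause (2));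
* `exists_kolyvaginDatum_freeRankOne_propagatedSelmerStructure_weil`: the same on p18's Weil form
  (no `θ`, no coisotropy binder; `hEP` instead);
* `exists_kolyvaginDatum_freeRankOne_propagatedSelmerStructure_of_towerSurj`: the same on p18's
  `…_of_towerSurj` (also (H.3) discharged, by p04-gen3's `hH3_three_of_towerSurj`);
* `exists_eta_kolyvaginDatum_freeRankOne_propagatedSelmerStructure_of_towerSurj`: with the
  primitive roots chosen too (`∃ η D, …`) — of the Kolyvagin-datum binders NOTHING remains.

Print locator for the comparison map supplied (n1011-lit, page check of 2026-08-21): the `fs` of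
`HasCanonicalComparison N η` = [Mazur–Rubin, Mem. AMS 799, Def. 1.2.2 with Lemma 1.2.1/1.2.3,
pp. 10–11] `φ^{fs}_ℓ` followed by the contraction `H¹_s ⊗ 𝔽^× → H¹_s`, `x ⊗ η ↦ x`, against the
fixed generator `η` (= [Rubin, PCMS 18, Def. 1.9.6 / Ex. 1.9.7, pp. 14–15] `φ^{ut}`); it depends on
`η` exactly as Kurihara numbers depend on the primitive roots `η_ℓ` (Kim §2.2.2).

Remaining binders, unchanged and explicit: the `3`-adic tower, `τ` with (H.2), (H.3), the
Poitou–Tate family `inv`, `S`, core rank one of `𝓕̄_can` (the located gap (Lp)), and — in the first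
form — `θ` + coisotropy; CONDITIONAL on the named fact `hS24` (Sakamoto 2024 Thm. 4.4 (1)) exactly as
the two source theorems.  Nothing booked; no mark changed.

References: R. Sakamoto, JTNB 36 (2024) Thm. 4.4; K. Rubin, PCMI 18 (2011) Def. 1.9.6; C.-H. Kim,
AJM 148 (2026) §2.2.2.
-/

noncomputable section

open scoped Classical NumberField ContRepresentation
open Field NumberField IsDedekindDomain
open WeierstrassCurve Literature.NumberTheory.EllipticCurves Literature.NumberTheory.GaloisRepresentations
  Literature.NumberTheory.GaloisRepresentations.DiscreteGaloisModule Literature.NumberTheory.GaloisCohomology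

namespace Summit.BirchSwinnertonDyer.Rank1Residual.GaloisImage

variable (W : WeierstrassCurve ℚ) [W.IsElliptic]

/-- **p13's N11 instance of Sakamoto Thm. 4.4 (1) with the Kolyvagin datum supplied by T-HCC**:
given primitive roots `η` at Sakamoto's primes, THERE IS a datum `D` with
`D.primes = frobeniusClassPrimes …`, `D.transverse = cyclotomicTransverse …`,
`D.HasCanonicalComparison (3^(k+1)) η`, for which `KS₁(E[3^{k+1}], 𝓕_can)` is free of rank one over
`ℤ/3^{k+1}` and clause (2) holds.  All other binders are p13's verbatim; CONDITIONAL on `hS24`.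
[folklore] -/
theorem exists_kolyvaginDatum_freeRankOne_propagatedSelmerStructure
    (hS24 : Sakamoto2024.kolyvaginSystems_freeRankOne_zmod_three_pow) (k : ℕ)
    [Finite (geomTorsion W ((3 : ℕ) : ℤ))] [Finite (geomTorsion W (((3 : ℕ) : ℤ) ^ k * ((3 : ℕ) : ℤ)))]
    (htower : ∀ n : ℕ, W.HasSurjectiveModNGaloisRep (3 ^ n : ℕ))
    (τ : absoluteGaloisGroup ℚ) (hτμ : τ ∈ rootsOfUnityFixer ℚ (3 ^ (k + 1)))
    (hτq : Nonempty (cokerSubOne (W.torsionGaloisModule (((3 : ℕ) : ℤ) ^ k * ((3 : ℕ) : ℤ))) τ ≃+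
      ZMod (3 ^ (k + 1))))
    (hH3 : ∀ f : contOneCocycles (W.torsionGaloisModule ((3 : ℕ) : ℤ)).toTopRep,
      (∀ u : absoluteGaloisGroup ℚ, (W.torsionGaloisModule (((3 : ℕ) : ℤ) ^ k * ((3 : ℕ) : ℤ))) u = 1 →
        u ∈ rootsOfUnityFixer ℚ (3 ^ (k + 1)) → f.1 u = 0) →
        oneCocycleClass (W.torsionGaloisModule ((3 : ℕ) : ℤ)).toTopRep f = 0)
    (θ : (W.torsionGaloisModule ((3 : ℕ) : ℤ)).toContRepresentation →ⁱL
      ((W.torsionGaloisModule ((3 : ℕ) : ℤ)).tateDual 3).toContRepresentation)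
    (hθ : Function.Bijective θ)
    (inv : LocalInvariants ℚ 3) (hperf : inv.IsPerfect) (hsum : inv.SumLocalTermEqZero)
    (hunro : inv.UnramifiedOrthogonal) (hcompl : inv.SelmerComplement)
    (S : Finset (Place ℚ)) (hS : ∀ w : InfinitePlace ℚ, (Sum.inl w : Place ℚ) ∈ S)
    (hS' : ∀ v : HeightOneSpectrum (𝓞 ℚ), (Sum.inr v : Place ℚ) ∉ S →
      ((3 : ℕ) : 𝓞 ℚ) ∉ v.asIdeal ∧ GaloisRep.IsUnramifiedAt v (W.torsionGaloisModule (((3 : ℕ) : ℤ) ^ k * ((3 : ℕ) : ℤ))))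
    (hunr : (propagatedSelmerStructure W 3 k).IsUnramifiedOutside S)
    (hCR : LocalInvariants.HasCoreRank inv (propagatedSelmerStructureOne W 3) 3 1)
    (hco : inv.IsResiduallyCoisotropic (propagatedSelmerStructureOne W 3) θ S)
    (η : (q : HeightOneSpectrum (𝓞 ℚ)) → (ZMod (Ideal.absNorm q.asIdeal))ˣ)
    (hη : ∀ q ∈ frobeniusClassPrimes (W.torsionGaloisModule (((3 : ℕ) : ℤ) ^ k * ((3 : ℕ) : ℤ)))
      {v | (Sum.inr v : Place ℚ) ∈ S} τ (3 ^ (k + 1)), Subgroup.zpowers (η q) = ⊤) :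
    ∃ D : KolyvaginDatum (W.torsionGaloisModule (((3 : ℕ) : ℤ) ^ k * ((3 : ℕ) : ℤ))),
      D.primes = frobeniusClassPrimes (W.torsionGaloisModule (((3 : ℕ) : ℤ) ^ k * ((3 : ℕ) : ℤ)))
        {v | (Sum.inr v : Place ℚ) ∈ S} τ (3 ^ (k + 1)) ∧
      D.transverse = cyclotomicTransverse (W.torsionGaloisModule (((3 : ℕ) : ℤ) ^ k * ((3 : ℕ) : ℤ))) ∧
      D.HasCanonicalComparison (3 ^ (k + 1)) η ∧
      (KolyvaginSystem.IsFreeRankOneZMod (D.kolyvaginSystems (propagatedSelmerStructure W 3 k))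
          (3 ^ (k + 1)) ∧
        ∀ (d : Finset (HeightOneSpectrum (𝓞 ℚ))) (hd : D.IsLevel d),
          LocalInvariants.lambdaStar inv ((D.atLevel (propagatedSelmerStructure W 3 k) d).induced
            (W.torsionMulBy (((3 : ℕ) : ℤ) ^ k) ((3 : ℕ) : ℤ))) 3 = 0 →
          Function.Bijective fun κ : D.kolyvaginSystems (propagatedSelmerStructure W 3 k) =>
            (⟨κ.1 d, ((KolyvaginDatum.mem_kolyvaginSystems_iff D _ κ.1).mp κ.2).mem_selmerGroup
                d hd⟩ : (D.atLevel (propagatedSelmerStructure W 3 k) d).selmerGroup)) := by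
  obtain ⟨D, hP, hT, hD⟩ :=
    FSComp.exists_kolyvaginDatum_hasCanonicalComparison_frobeniusClassPrimes
      (W.torsionGaloisModule (((3 : ℕ) : ℤ) ^ k * ((3 : ℕ) : ℤ))) (3 ^ (k + 1))
      {v | (Sum.inr v : Place ℚ) ∈ S} hτμ hτq
      (cyclotomicTransverse (W.torsionGaloisModule (((3 : ℕ) : ℤ) ^ k * ((3 : ℕ) : ℤ)))) η hη
  exact ⟨D, hP, hT, hD, kolyvaginSystems_freeRankOne_propagatedSelmerStructure W hS24 k htower τ hτμ
    hτq hH3 θ hθ inv hperf hsum hunro hcompl S hS hS' hunr hCR hco D η hP hT hD⟩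

/-- **p18's Weil form with the Kolyvagin datum supplied by T-HCC** (no `θ`, no coisotropy binder;
`hEP` = Tate's local Euler–Poincaré characteristic at the finite places of `S`, a named fact):
for every family `η` of primitive roots at Sakamoto's primes there is `D` with THE canonical
comparison maps for which `KS₁(E[3^{k+1}], 𝓕_can)` is free of rank one.  CONDITIONAL on `hS24`.
[folklore] -/
theorem exists_kolyvaginDatum_freeRankOne_propagatedSelmerStructure_weil
    (hS24 : Sakamoto2024.kolyvaginSystems_freeRankOne_zmod_three_pow) (k : ℕ)
    [Finite (geomTorsion W ((3 : ℕ) : ℤ))]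
    (htower : ∀ n : ℕ, W.HasSurjectiveModNGaloisRep (3 ^ n : ℕ))
    (τ : absoluteGaloisGroup ℚ) (hτμ : τ ∈ rootsOfUnityFixer ℚ (3 ^ (k + 1)))
    (hτq : Nonempty (cokerSubOne (W.torsionGaloisModule (((3 : ℕ) : ℤ) ^ k * ((3 : ℕ) : ℤ))) τ ≃+
      ZMod (3 ^ (k + 1))))
    (hH3 : ∀ f : contOneCocycles (W.torsionGaloisModule ((3 : ℕ) : ℤ)).toTopRep,
      (∀ u : absoluteGaloisGroup ℚ, (W.torsionGaloisModule (((3 : ℕ) : ℤ) ^ k * ((3 : ℕ) : ℤ))) u = 1 →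
        u ∈ rootsOfUnityFixer ℚ (3 ^ (k + 1)) → f.1 u = 0) →
        oneCocycleClass (W.torsionGaloisModule ((3 : ℕ) : ℤ)).toTopRep f = 0)
    (inv : LocalInvariants ℚ 3) (hperf : inv.IsPerfect) (hsum : inv.SumLocalTermEqZero)
    (hunro : inv.UnramifiedOrthogonal) (hcompl : inv.SelmerComplement)
    (S : Finset (Place ℚ)) (hS : ∀ w : InfinitePlace ℚ, (Sum.inl w : Place ℚ) ∈ S)
    (hS' : ∀ v : HeightOneSpectrum (𝓞 ℚ), (Sum.inr v : Place ℚ) ∉ S →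
      ((3 : ℕ) : 𝓞 ℚ) ∉ v.asIdeal ∧ GaloisRep.IsUnramifiedAt v
        (W.torsionGaloisModule (((3 : ℕ) : ℤ) ^ k * ((3 : ℕ) : ℤ))))
    (hunr : (propagatedSelmerStructure W 3 k).IsUnramifiedOutside S)
    (hEP : ∀ v : HeightOneSpectrum (𝓞 ℚ), (Sum.inr v : Place ℚ) ∈ S →
      localEulerPoincareCharacteristic (v.adicCompletion ℚ))
    (hCR : LocalInvariants.HasCoreRank inv (propagatedSelmerStructureOne W 3) 3 1)
    (η : (q : HeightOneSpectrum (𝓞 ℚ)) → (ZMod (Ideal.absNorm q.asIdeal))ˣ)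
    (hη : ∀ q ∈ frobeniusClassPrimes (W.torsionGaloisModule (((3 : ℕ) : ℤ) ^ k * ((3 : ℕ) : ℤ)))
      {v | (Sum.inr v : Place ℚ) ∈ S} τ (3 ^ (k + 1)), Subgroup.zpowers (η q) = ⊤) :
    ∃ D : KolyvaginDatum (W.torsionGaloisModule (((3 : ℕ) : ℤ) ^ k * ((3 : ℕ) : ℤ))),
      D.primes = frobeniusClassPrimes (W.torsionGaloisModule (((3 : ℕ) : ℤ) ^ k * ((3 : ℕ) : ℤ)))
        {v | (Sum.inr v : Place ℚ) ∈ S} τ (3 ^ (k + 1)) ∧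
      D.transverse = cyclotomicTransverse (W.torsionGaloisModule (((3 : ℕ) : ℤ) ^ k * ((3 : ℕ) : ℤ))) ∧
      D.HasCanonicalComparison (3 ^ (k + 1)) η ∧
      (KolyvaginSystem.IsFreeRankOneZMod (D.kolyvaginSystems (propagatedSelmerStructure W 3 k))
          (3 ^ (k + 1)) ∧
        ∀ (d : Finset (HeightOneSpectrum (𝓞 ℚ))) (hd : D.IsLevel d),
          LocalInvariants.lambdaStar inv ((D.atLevel (propagatedSelmerStructure W 3 k) d).induced
            (W.torsionMulBy (((3 : ℕ) : ℤ) ^ k) ((3 : ℕ) : ℤ))) 3 = 0 →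
          Function.Bijective fun κ : D.kolyvaginSystems (propagatedSelmerStructure W 3 k) =>
            (⟨κ.1 d, ((KolyvaginDatum.mem_kolyvaginSystems_iff D _ κ.1).mp κ.2).mem_selmerGroup
                d hd⟩ : (D.atLevel (propagatedSelmerStructure W 3 k) d).selmerGroup)) := by
  obtain ⟨D, hP, hT, hD⟩ :=
    FSComp.exists_kolyvaginDatum_hasCanonicalComparison_frobeniusClassPrimes
      (W.torsionGaloisModule (((3 : ℕ) : ℤ) ^ k * ((3 : ℕ) : ℤ))) (3 ^ (k + 1))
      {v | (Sum.inr v : Place ℚ) ∈ S} hτμ hτq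
      (cyclotomicTransverse (W.torsionGaloisModule (((3 : ℕ) : ℤ) ^ k * ((3 : ℕ) : ℤ)))) η hη
  exact ⟨D, hP, hT, hD, kolyvaginSystems_freeRankOne_propagatedSelmerStructure_weil W hS24 k htower
    τ hτμ hτq hH3 inv hperf hsum hunro hcompl S hS hS' hunr hEP hCR D η hP hT hD⟩

/-- **p18's `…_of_towerSurj` form ((H.3) discharged too) with the Kolyvagin datum supplied by
T-HCC**: given primitive roots `η` at Sakamoto's primes, `∃ D` with THE canonical comparison maps
and the full conclusion (1) + (2) of Sakamoto Thm. 4.4 for `(E[3^{k+1}], 𝓕_can)`.  Binders left: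
`hS24`, `k`, `[Finite E[3]]`, the tower, `τ` (`hτμ`, `hτq`), `inv` (four properties), `S` (`hS`,
`hS'`, `hunr`), `hEP`, core rank one `hCR`, and `η` with `hη`.  CONDITIONAL on `hS24`. [folklore] -/
theorem exists_kolyvaginDatum_freeRankOne_propagatedSelmerStructure_of_towerSurj
    (hS24 : Sakamoto2024.kolyvaginSystems_freeRankOne_zmod_three_pow) (k : ℕ)
    [Finite (geomTorsion W ((3 : ℕ) : ℤ))]
    (htower : ∀ n : ℕ, W.HasSurjectiveModNGaloisRep (3 ^ n : ℕ))
    (τ : absoluteGaloisGroup ℚ) (hτμ : τ ∈ rootsOfUnityFixer ℚ (3 ^ (k + 1)))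
    (hτq : Nonempty (cokerSubOne (W.torsionGaloisModule (((3 : ℕ) : ℤ) ^ k * ((3 : ℕ) : ℤ))) τ ≃+
      ZMod (3 ^ (k + 1))))
    (inv : LocalInvariants ℚ 3) (hperf : inv.IsPerfect) (hsum : inv.SumLocalTermEqZero)
    (hunro : inv.UnramifiedOrthogonal) (hcompl : inv.SelmerComplement)
    (S : Finset (Place ℚ)) (hS : ∀ w : InfinitePlace ℚ, (Sum.inl w : Place ℚ) ∈ S)
    (hS' : ∀ v : HeightOneSpectrum (𝓞 ℚ), (Sum.inr v : Place ℚ) ∉ S →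
      ((3 : ℕ) : 𝓞 ℚ) ∉ v.asIdeal ∧ GaloisRep.IsUnramifiedAt v
        (W.torsionGaloisModule (((3 : ℕ) : ℤ) ^ k * ((3 : ℕ) : ℤ))))
    (hunr : (propagatedSelmerStructure W 3 k).IsUnramifiedOutside S)
    (hEP : ∀ v : HeightOneSpectrum (𝓞 ℚ), (Sum.inr v : Place ℚ) ∈ S →
      localEulerPoincareCharacteristic (v.adicCompletion ℚ))
    (hCR : LocalInvariants.HasCoreRank inv (propagatedSelmerStructureOne W 3) 3 1)
    (η : (q : HeightOneSpectrum (𝓞 ℚ)) → (ZMod (Ideal.absNorm q.asIdeal))ˣ)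
    (hη : ∀ q ∈ frobeniusClassPrimes (W.torsionGaloisModule (((3 : ℕ) : ℤ) ^ k * ((3 : ℕ) : ℤ)))
      {v | (Sum.inr v : Place ℚ) ∈ S} τ (3 ^ (k + 1)), Subgroup.zpowers (η q) = ⊤) :
    ∃ D : KolyvaginDatum (W.torsionGaloisModule (((3 : ℕ) : ℤ) ^ k * ((3 : ℕ) : ℤ))),
      D.primes = frobeniusClassPrimes (W.torsionGaloisModule (((3 : ℕ) : ℤ) ^ k * ((3 : ℕ) : ℤ)))
        {v | (Sum.inr v : Place ℚ) ∈ S} τ (3 ^ (k + 1)) ∧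
      D.transverse = cyclotomicTransverse (W.torsionGaloisModule (((3 : ℕ) : ℤ) ^ k * ((3 : ℕ) : ℤ))) ∧
      D.HasCanonicalComparison (3 ^ (k + 1)) η ∧
      (KolyvaginSystem.IsFreeRankOneZMod (D.kolyvaginSystems (propagatedSelmerStructure W 3 k))
          (3 ^ (k + 1)) ∧
        ∀ (d : Finset (HeightOneSpectrum (𝓞 ℚ))) (hd : D.IsLevel d),
          LocalInvariants.lambdaStar inv ((D.atLevel (propagatedSelmerStructure W 3 k) d).induced
            (W.torsionMulBy (((3 : ℕ) : ℤ) ^ k) ((3 : ℕ) : ℤ))) 3 = 0 →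
          Function.Bijective fun κ : D.kolyvaginSystems (propagatedSelmerStructure W 3 k) =>
            (⟨κ.1 d, ((KolyvaginDatum.mem_kolyvaginSystems_iff D _ κ.1).mp κ.2).mem_selmerGroup
                d hd⟩ : (D.atLevel (propagatedSelmerStructure W 3 k) d).selmerGroup)) := by
  obtain ⟨D, hP, hT, hD⟩ :=
    FSComp.exists_kolyvaginDatum_hasCanonicalComparison_frobeniusClassPrimes
      (W.torsionGaloisModule (((3 : ℕ) : ℤ) ^ k * ((3 : ℕ) : ℤ))) (3 ^ (k + 1))
      {v | (Sum.inr v : Place ℚ) ∈ S} hτμ hτq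
      (cyclotomicTransverse (W.torsionGaloisModule (((3 : ℕ) : ℤ) ^ k * ((3 : ℕ) : ℤ)))) η hη
  exact ⟨D, hP, hT, hD, kolyvaginSystems_freeRankOne_propagatedSelmerStructure_of_towerSurj W hS24 k
    htower τ hτμ hτq inv hperf hsum hunro hcompl S hS hS' hunr hEP hCR D η hP hT hD⟩

/-- **The same with the primitive roots chosen as well** (`∃ η D, …`): of the Kolyvagin-datum
binders of the N11 instance NOTHING remains — `KS₁(E[3^{k+1}], 𝓕_can, 𝒫)` is free of rank one over
`ℤ/3^{k+1}` for THE canonical datum at Sakamoto's primes, from the fact `hS24`, the tower, `τ`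
with (H.2), the Poitou–Tate family, `S`, `hEP` and core rank one.  CONDITIONAL on `hS24`.
[folklore] -/
theorem exists_eta_kolyvaginDatum_freeRankOne_propagatedSelmerStructure_of_towerSurj
    (hS24 : Sakamoto2024.kolyvaginSystems_freeRankOne_zmod_three_pow) (k : ℕ)
    [Finite (geomTorsion W ((3 : ℕ) : ℤ))]
    (htower : ∀ n : ℕ, W.HasSurjectiveModNGaloisRep (3 ^ n : ℕ))
    (τ : absoluteGaloisGroup ℚ) (hτμ : τ ∈ rootsOfUnityFixer ℚ (3 ^ (k + 1)))
    (hτq : Nonempty (cokerSubOne (W.torsionGaloisModule (((3 : ℕ) : ℤ) ^ k * ((3 : ℕ) : ℤ))) τ ≃+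
      ZMod (3 ^ (k + 1))))
    (inv : LocalInvariants ℚ 3) (hperf : inv.IsPerfect) (hsum : inv.SumLocalTermEqZero)
    (hunro : inv.UnramifiedOrthogonal) (hcompl : inv.SelmerComplement)
    (S : Finset (Place ℚ)) (hS : ∀ w : InfinitePlace ℚ, (Sum.inl w : Place ℚ) ∈ S)
    (hS' : ∀ v : HeightOneSpectrum (𝓞 ℚ), (Sum.inr v : Place ℚ) ∉ S →
      ((3 : ℕ) : 𝓞 ℚ) ∉ v.asIdeal ∧ GaloisRep.IsUnramifiedAt v
        (W.torsionGaloisModule (((3 : ℕ) : ℤ) ^ k * ((3 : ℕ) : ℤ))))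
    (hunr : (propagatedSelmerStructure W 3 k).IsUnramifiedOutside S)
    (hEP : ∀ v : HeightOneSpectrum (𝓞 ℚ), (Sum.inr v : Place ℚ) ∈ S →
      localEulerPoincareCharacteristic (v.adicCompletion ℚ))
    (hCR : LocalInvariants.HasCoreRank inv (propagatedSelmerStructureOne W 3) 3 1) :
    ∃ (η : (q : HeightOneSpectrum (𝓞 ℚ)) → (ZMod (Ideal.absNorm q.asIdeal))ˣ)
      (D : KolyvaginDatum (W.torsionGaloisModule (((3 : ℕ) : ℤ) ^ k * ((3 : ℕ) : ℤ)))),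
      D.primes = frobeniusClassPrimes (W.torsionGaloisModule (((3 : ℕ) : ℤ) ^ k * ((3 : ℕ) : ℤ)))
        {v | (Sum.inr v : Place ℚ) ∈ S} τ (3 ^ (k + 1)) ∧
      D.transverse = cyclotomicTransverse (W.torsionGaloisModule (((3 : ℕ) : ℤ) ^ k * ((3 : ℕ) : ℤ))) ∧
      D.HasCanonicalComparison (3 ^ (k + 1)) η ∧
      KolyvaginSystem.IsFreeRankOneZMod (D.kolyvaginSystems (propagatedSelmerStructure W 3 k))
        (3 ^ (k + 1)) := by
  obtain ⟨η, D, hP, hT, hD⟩ :=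
    FSComp.exists_eta_kolyvaginDatum_hasCanonicalComparison_frobeniusClassPrimes
      (W.torsionGaloisModule (((3 : ℕ) : ℤ) ^ k * ((3 : ℕ) : ℤ))) (3 ^ (k + 1))
      {v | (Sum.inr v : Place ℚ) ∈ S} hτμ hτq
      (cyclotomicTransverse (W.torsionGaloisModule (((3 : ℕ) : ℤ) ^ k * ((3 : ℕ) : ℤ))))
  exact ⟨η, D, hP, hT, hD, (kolyvaginSystems_freeRankOne_propagatedSelmerStructure_of_towerSurj W hS24
    k htower τ hτμ hτq inv hperf hsum hunro hcompl S hS hS' hunr hEP hCR D η hP hT hD).1⟩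

end Summit.BirchSwinnertonDyer.Rank1Residual.GaloisImage

end
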